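/-
Fleet lead `ym-wcr-19609-p1` (seat prover-ym-wcr-19609-p1-g2-0), route `WeakCouplingRates`, crux `BulkDominatesColdBoxW`
(stmt-QuantumFields-19609), line `dlr-chessboard` (v8): A-cov assembly — the core with datum in polynomial (`rpow`) form.
-/
import Summits.QuantumFields.YangMills.Theorems.WeakCouplingRatesBulkDominatesColdBoxWKernelCovDatumBounds

/-!
# Crux `BulkDominatesColdBoxW`, stub `stub_kernelCovExpansion`: the A-cov expansion with datum at fixed `β`, polynomial form

**`abs_kernelCov_sub_gaussian_le_rpow`.**  The deterministic core with datum `abs_kernelCov_sub_gaussian_le_datum` (`…KernelCovDatumCore`),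
instantiated with the datum package's concrete parameters (`r² = 2·278400²β^{6θ+2δ−1}`, energy `16(2H+3)⁴β^{2δ−1}`), the YM rarity `e^{−β^ε}`,
the Gaussian threshold `R = 2β^{ε/2}`, the T4 link bound and the sandwich radius `17650000·X⁴β^{3θ+δ−1/2}`, and with every bookkeeping
quantity replaced by its monomial bound from `…KernelCovDatumBounds`: under finitely many smallness inequalities AT `β` of the two shapes
`C·X^k·β^a ≤ β^b` and `C·X^k·e^{−β^ε} ≤ β^b` (`X = 2H+3`; all eventually true for `H = ⌈β^θ⌉`, `θ` small, by `…EventuallyPow`), the kernel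
covariance of the centre pair is its Gaussian value up to `β^{−θ/2}`:
`|β²·Cov_{γ(·|W)}(c_p,c_q) − (3/2)C_D(p,q)² − 2β(Σ_c F̄_c(p)F̄_c(q))C_D(p,q)| ≤ β^{−θ/2}`.
The eight error terms (YM large fields, tilt ×2, Gaussian bad mass, surrogate ×2, `√P` ×2) are each `≤ β^{−θ}` or `≤ 2β^{−θ}`.
Pure real arithmetic over tree theorems; no sorry; no new definition; standard axioms.  NOT a claim about the mass gap.
-/

set_option autoImplicit false

noncomputable section

open MeasureTheory ProbabilityTheory Finset Real
open Literature.Probability.LatticeModels (Site)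
open Literature.MathematicalPhysics.QuantumLattice
open Literature.MathematicalPhysics.QuantumFieldTheory
open Literature.MathematicalPhysics.QuantumFieldTheory.LatticeMaxwell
open Literature.MathematicalPhysics.QuantumFieldTheory.AxialGauge

namespace Summit.QuantumFields.YangMills.Theorems.WeakCouplingRates

set_option maxHeartbeats 400000 in
/-- **The A-cov expansion with datum at fixed `β`, polynomial form.**  For `β ≥ 1`, `1 ≤ H`, `T ≤ H`, exponents `0 < θ`, `0 ≤ δ`,
`ε/2 ≤ 3θ+δ ≤ ε`, a box datum `W` charted off the cold box by `ϑ` with the datum package's bounds (size `2·278400²β^{6θ+2δ−1}`, forest zero,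
energy `16(2H+3)⁴β^{2δ−1}`) and the YM rarity `γ(·|W)(coldGoodSetᶜ) ≤ e^{−β^ε}`: if the listed monomial smallness inequalities hold AT `β`
(`X = 2H+3`; each is `C·X^k·β^a ≤ β^b` or `C·X^k·e^{−β^ε} ≤ β^b`, eventually true for `H = ⌈β^θ⌉` by `…EventuallyPow`), then
`|β²·Cov_{γ(·|W)}(c_p, c_q) − (3/2)C_D(p,q)² − 2β(Σ_c F̄_c(p)F̄_c(q))C_D(p,q)| ≤ β^{−θ/2}` at the centre pair. -/
theorem abs_kernelCov_sub_gaussian_le_rpow {β θ δ ε : ℝ} {H T : ℕ} (hβ : 1 ≤ β) (hH : 1 ≤ H) (hT : T ≤ H)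
    (hθ : 0 < θ) (hδ : 0 ≤ δ) (hδε : 3 * θ + δ ≤ ε) (hε2 : ε / 2 ≤ 3 * θ + δ)
    {W : LGConfig 4 (Matrix.specialUnitaryGroup (Fin 2) ℂ)} {ϑ : Fin 3 → Literature.MathematicalPhysics.QuantumLattice.ZdEdge 4 → ℝ}
    {s : Fin 3 → DirFree H → ℝ}
    (hW : ∀ e, e ∉ boxEdges 4 (2 * H + 1) → W e = gnomonicChart (fun c => ϑ c e))
    (hϑ : ∀ e, e ∉ boxEdges 4 (2 * H + 1) → ∑ c, ϑ c e ^ 2 ≤ 2 * 278400 ^ 2 * β ^ (6 * θ + 2 * δ - 1))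
    (hforest : ∀ x : Site 4, (∀ k : Fin 4, 1 ≤ x k ∧ x k + 1 ≤ 2 * (H : ℤ)) → ∀ c, ϑ c (x, 0) = 0)
    (hE : ∑ c, formM (fun e => e ∉ dirFreeEdges H) dirCorner (2 * H + 3) (ϑ c) (s c) ≤ 16 * (2 * (H : ℝ) + 3) ^ 4 * β ^ (2 * δ - 1))
    (hpY : (boxKernel β H W).real (coldGoodSet β ε H)ᶜ ≤ Real.exp (-(β ^ ε)))
    (hm4 : 4 * 14400005 * (2 * (H : ℝ) + 3) ^ 2 * β ^ (ε - 1 / 2) ≤ 1)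
    (hms4 : 4 * 17650000 * (2 * (H : ℝ) + 3) ^ 4 * β ^ (3 * θ + δ - 1 / 2) ≤ 1)
    (hwin1 : 3 * (3 / 2 * 2400008 ^ 2) * (2 * (H : ℝ) + 3) ^ 4 * β ^ (6 * θ + 2 * δ - 1) ≤ β ^ (2 * ε - 1))
    (hwin2 : 3 * (362 * 17650000 ^ 3) * (2 * (H : ℝ) + 3) ^ 12 * β ^ (9 * θ + 3 * δ - 3 / 2) ≤ β ^ (2 * ε - 1))
    (hw1 : 4 * (43440 * 14400005 ^ 3) * (2 * (H : ℝ) + 3) ^ 10 * β ^ (3 * ε - 1 / 2) ≤ 1)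
    (hw2 : 4 * (8 * 14400005 ^ 2) * (2 * (H : ℝ) + 3) ^ 8 * β ^ (2 * ε - 1) ≤ 1)
    (h1 : 96 * β ^ (2 : ℝ) * Real.exp (-(β ^ ε)) ≤ β ^ (-θ))
    (h2a : 12 * (43440 * 14400005 ^ 3) * (2 * (H : ℝ) + 3) ^ 10 * β ^ (7 * ε - 1 / 2) ≤ β ^ (-θ))
    (h2b : 12 * (8 * 14400005 ^ 2) * (2 * (H : ℝ) + 3) ^ 8 * β ^ (6 * ε - 1) ≤ β ^ (-θ))
    (h3 : 4320 * (2 * (H : ℝ) + 3) ^ 4 * Real.exp (-(β ^ ε)) ≤ β ^ (-θ - 4 * ε))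
    (h4a : 724 * 14400005 ^ 3 * (2 * (H : ℝ) + 3) ^ 6 * β ^ (5 * ε - 1 / 2) ≤ β ^ (-θ))
    (h4b : 724 * 14400005 ^ 3 * (6 * 2400006 ^ 2 + 11) * (2 * (H : ℝ) + 3) ^ 10 * β ^ (3 * ε + 2 * (3 * θ + δ) - 1 / 2) ≤ β ^ (-θ))
    (h5a : 54 * (6 * 2400006 ^ 2 + 11) * (2 * (H : ℝ) + 3) ^ 6 * Real.exp (-(β ^ ε)) ≤ β ^ (-θ - (2 * ε + 2 * (3 * θ + δ))))
    (h5b : 108 * (6 * 2400006 ^ 2 + 11) ^ 2 * (2 * (H : ℝ) + 3) ^ 10 * Real.exp (-(β ^ ε)) ≤ β ^ (-θ - 4 * (3 * θ + δ)))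
    (hsum : 8 * β ^ (-θ) ≤ β ^ (-(θ / 2))) :
    |β ^ 2 * ((∫ U, plaqCostAt (fundamentalRep (Fin 2)) (boxCentre H) 1 2 U *
              plaqCostAt (fundamentalRep (Fin 2)) (boxCentre H + Pi.single 0 (T : ℤ)) 1 2 U ∂(boxKernel β H W)) -
          (∫ U, plaqCostAt (fundamentalRep (Fin 2)) (boxCentre H) 1 2 U ∂(boxKernel β H W)) *
            (∫ U, plaqCostAt (fundamentalRep (Fin 2)) (boxCentre H + Pi.single 0 (T : ℤ)) 1 2 U ∂(boxKernel β H W))) -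
        3 / 2 * boxDirProjKernel H (boxCentre H, 1, 2) (boxCentre H + Pi.single 0 (T : ℤ), 1, 2) ^ 2 -
        2 * β * (∑ c,
            sCirc (glue (pin := fun e => e ∉ dirFreeEdges H) dirCorner (2 * H + 3) (ϑ c)
                (mean (fun e => e ∉ dirFreeEdges H) dirCorner (2 * H + 3) (ϑ c))) (boxCentre H, 1, 2) *
              sCirc (glue (pin := fun e => e ∉ dirFreeEdges H) dirCorner (2 * H + 3) (ϑ c)
                (mean (fun e => e ∉ dirFreeEdges H) dirCorner (2 * H + 3) (ϑ c))) (boxCentre H + Pi.single 0 (T : ℤ), 1, 2)) *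
          boxDirProjKernel H (boxCentre H, 1, 2) (boxCentre H + Pi.single 0 (T : ℤ), 1, 2)| ≤ β ^ (-(θ / 2)) := by
  have hβ0 : 0 < β := by linarith
  have hc0 : 0 ≤ 3 * θ + δ := by linarith
  -- the parameter bounds (before abbreviating)
  obtain ⟨hr0, hr2, -⟩ := datum_r_bounds (θ := θ) (δ := δ) hβ0
  have hX1 : (1 : ℝ) ≤ 2 * (H : ℝ) + 3 := by have : (0 : ℝ) ≤ H := Nat.cast_nonneg H; linarith
  have hR'le := datum_Rprime_le (δ := δ) hβ hθ.le hX1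
  have hmle := datum_m_le (H := H) hβ hδε
  obtain ⟨hR0, -, hPle, hsqPle⟩ := datum_P_le (ε := ε) (H := H) hβ0
  -- abbreviations
  set X : ℝ := 2 * (H : ℝ) + 3 with hXdef
  set r : ℝ := Real.sqrt (2 * 278400 ^ 2 * β ^ (6 * θ + 2 * δ - 1)) with hrdef
  set R' : ℝ := Real.sqrt (2 * β * (16 * X ^ 4 * β ^ (2 * δ - 1))) + 4 * (Real.sqrt (2 * β) * r) with hR'def
  set m : ℝ := Real.sqrt 2 * ((12 * (H : ℝ) ^ 2 + 2 * H + 1) * (Real.sqrt (β ^ (2 * ε - 1)) + 8 * r)) with hmdef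
  set R : ℝ := 2 * β ^ (ε / 2) with hRdef
  set ms : ℝ := 17650000 * X ^ 4 * β ^ (3 * θ + δ - 1 / 2) with hmsdef
  set P : ℝ := 720 * (2 * (H : ℝ) + 1) ^ 4 * Real.exp (-R ^ 2 / 2) with hPdef
  set E : ℝ := Real.exp (-(β ^ ε)) with hEdef
  have hE0 : 0 ≤ E := (Real.exp_pos _).le
  have hX0 : 0 ≤ X := by linarith
  have hR'0 : 0 ≤ R' := by rw [hR'def]; positivity
  have hm0 : 0 ≤ m := by rw [hmdef]; positivity
  have hms0 : 0 ≤ ms := by rw [hmsdef]; positivity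
  obtain ⟨hmsle, hRRle⟩ := datum_sandwich_le (ε := ε) (H := H) hβ hθ.le hδ hε2 hR'0 hR'le
  -- the hypotheses of the core
  have hϑ' : ∀ e, e ∉ boxEdges 4 (2 * H + 1) → ∑ c, ϑ c e ^ 2 ≤ r ^ 2 := fun e he => by rw [hr2]; exact hϑ e he
  have hpY1 : E < 1 := by
    rw [hEdef, Real.exp_lt_one_iff]; have : 0 < β ^ ε := Real.rpow_pos_of_pos hβ0 ε; linarith
  have hm4' : m ≤ 1 / 4 := by
    have : 0 ≤ 14400005 * X ^ 2 * β ^ (ε - 1 / 2) := by positivity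
    linarith
  have hms' : r ^ 2 + 3 * ((12 * (H : ℝ) ^ 2 + 2 * H + 1) * ((R + R') + 4 * (Real.sqrt (2 * β) * r))) ^ 2 / (2 * β) ≤ ms ^ 2 := hmsle
  have hms4' : ms ≤ 1 / 4 := by
    have : 0 ≤ 17650000 * X ^ 4 * β ^ (3 * θ + δ - 1 / 2) := by positivity
    rw [hmsdef]; linarith
  have hms3 : 362 * ms ^ 3 = 362 * 17650000 ^ 3 * X ^ 12 * β ^ (9 * θ + 3 * δ - 3 / 2) := by
    rw [hmsdef, mul_pow, mul_pow, rpow_pow_eq_rpow hβ0.le]; push_cast; ring_nf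
  have hwin : 3 * (R + R') ^ 2 / (2 * β) + 362 * ms ^ 3 < β ^ (2 * ε - 1) := by
    have hpos : 0 < β ^ (2 * ε - 1) := Real.rpow_pos_of_pos hβ0 _
    rw [hms3]
    have hA : 3 * (R + R') ^ 2 / (2 * β) ≤ β ^ (2 * ε - 1) / 3 := by
      have := hRRle; linarith
    have hB : 362 * 17650000 ^ 3 * X ^ 12 * β ^ (9 * θ + 3 * δ - 3 / 2) ≤ β ^ (2 * ε - 1) / 3 := by linarith
    linarith
  have hP1 : P < 1 := by
    have hb : β ^ (-θ - 4 * ε) ≤ 1 := Real.rpow_le_one_of_one_le_of_nonpos hβ (by linarith)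
    have : P ≤ 720 * X ^ 4 * E := hPle
    linarith
  -- the core
  have hcore := abs_kernelCov_sub_gaussian_le_datum (ε := ε) (R := R) (P := P) (pY := E) (m := m) (R' := R') (ms := ms)
    hβ hH hT hW hr0 hϑ' hforest hE hR'def.symm.le hpY hpY1 hmdef.symm.le hm4' hR0 hms0 hms' hms4' hwin hPdef.symm.le hP1
  refine hcore.trans ?_
  -- ## the term bounds
  have hrpow : ∀ a b : ℝ, β ^ a * β ^ b = β ^ (a + b) := fun a b => (Real.rpow_add hβ0 a b).symm
  have hM : (β ^ (2 * ε)) ^ 2 = β ^ (4 * ε) := by rw [rpow_pow_eq_rpow hβ0.le]; push_cast; ring_nf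
  have hM0 : 0 ≤ β ^ (2 * ε) := Real.rpow_nonneg hβ0.le _
  have hM4 : 0 ≤ β ^ (4 * ε) := Real.rpow_nonneg hβ0.le _
  -- (t2) the tilt term
  have hwle := datum_w_le (ε := ε) (H := H) hβ0 hm0 hmle
  have hw0 : 0 ≤ (#(plaquettesTouching (boxEdges 4 (2 * H + 1))) : ℝ) * (362 * β * m ^ 3) +
      2 * (Fintype.card (ColdFreeIdx H) : ℝ) * m ^ 2 := by positivity
  have hwhalf : (#(plaquettesTouching (boxEdges 4 (2 * H + 1))) : ℝ) * (362 * β * m ^ 3) +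
      2 * (Fintype.card (ColdFreeIdx H) : ℝ) * m ^ 2 ≤ 1 / 2 := by
    have hA : 0 ≤ 43440 * 14400005 ^ 3 * X ^ 10 * β ^ (3 * ε - 1 / 2) := by positivity
    have hB : 0 ≤ 8 * 14400005 ^ 2 * X ^ 8 * β ^ (2 * ε - 1) := by positivity
    linarith
  have ht2 : 3 * (β ^ (2 * ε)) ^ 2 * (Real.exp (2 * ((#(plaquettesTouching (boxEdges 4 (2 * H + 1))) : ℝ) * (362 * β * m ^ 3) +
      2 * (Fintype.card (ColdFreeIdx H) : ℝ) * m ^ 2)) - 1) ≤ 2 * β ^ (-θ) := by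
    have hexp := Literature.MathematicalPhysics.QuantumFieldTheory.Balaban1983to89.B9Eq376POneLetters.exp_two_mul_sub_one_le_four_mul hw0 hwhalf
    rw [hM]
    calc 3 * β ^ (4 * ε) * (Real.exp (2 * ((#(plaquettesTouching (boxEdges 4 (2 * H + 1))) : ℝ) * (362 * β * m ^ 3) +
          2 * (Fintype.card (ColdFreeIdx H) : ℝ) * m ^ 2)) - 1)
        ≤ 3 * β ^ (4 * ε) * (4 * (43440 * 14400005 ^ 3 * X ^ 10 * β ^ (3 * ε - 1 / 2) + 8 * 14400005 ^ 2 * X ^ 8 * β ^ (2 * ε - 1))) :=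
          mul_le_mul_of_nonneg_left (hexp.trans (by linarith)) (by positivity)
      _ = 12 * (43440 * 14400005 ^ 3) * X ^ 10 * (β ^ (4 * ε) * β ^ (3 * ε - 1 / 2)) +
          12 * (8 * 14400005 ^ 2) * X ^ 8 * (β ^ (4 * ε) * β ^ (2 * ε - 1)) := by ring
      _ = 12 * (43440 * 14400005 ^ 3) * X ^ 10 * β ^ (7 * ε - 1 / 2) + 12 * (8 * 14400005 ^ 2) * X ^ 8 * β ^ (6 * ε - 1) := by
          rw [hrpow, hrpow]; congr 1 <;> congr 1 <;> [congr 1; congr 1] <;> ring_nf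
      _ ≤ 2 * β ^ (-θ) := by linarith
  -- (t3) the Gaussian bad mass
  have ht3 : 6 * (β ^ (2 * ε)) ^ 2 * P ≤ β ^ (-θ) := by
    rw [hM]
    have hP0 : 0 ≤ P := by rw [hPdef]; positivity
    calc 6 * β ^ (4 * ε) * P ≤ 6 * β ^ (4 * ε) * (720 * X ^ 4 * E) := by gcongr
      _ = β ^ (4 * ε) * (4320 * X ^ 4 * E) := by ring
      _ ≤ β ^ (4 * ε) * β ^ (-θ - 4 * ε) := mul_le_mul_of_nonneg_left h3 hM4
      _ = β ^ (-θ) := by rw [hrpow]; ring_nf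
  -- (t4) the surrogate term
  obtain ⟨hτle, -⟩ := datum_tau_sq_le (ε := ε) hβ0 hm0 hmle
  obtain ⟨hK1, hK2, hK1sq⟩ := datum_K_le (c := 3 * θ + δ) hβ hc0 hX1 hR'0 hR'le
  have hτ0 : 0 ≤ 362 * β * m ^ 3 := by positivity
  have hK10 : 0 ≤ 6 * R' ^ 2 + 11 := by positivity
  have ht4 : 2 * (362 * β * m ^ 3) * (β ^ (2 * ε) + (6 * R' ^ 2 + 11)) ≤ 2 * β ^ (-θ) := by
    calc 2 * (362 * β * m ^ 3) * (β ^ (2 * ε) + (6 * R' ^ 2 + 11))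
        ≤ 2 * (362 * 14400005 ^ 3 * X ^ 6 * β ^ (3 * ε - 1 / 2)) *
            (β ^ (2 * ε) + (6 * 2400006 ^ 2 + 11) * X ^ 4 * β ^ (2 * (3 * θ + δ))) := by gcongr
      _ = 724 * 14400005 ^ 3 * X ^ 6 * (β ^ (3 * ε - 1 / 2) * β ^ (2 * ε)) +
          724 * 14400005 ^ 3 * (6 * 2400006 ^ 2 + 11) * X ^ 10 * (β ^ (3 * ε - 1 / 2) * β ^ (2 * (3 * θ + δ))) := by ring
      _ = 724 * 14400005 ^ 3 * X ^ 6 * β ^ (5 * ε - 1 / 2) +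
          724 * 14400005 ^ 3 * (6 * 2400006 ^ 2 + 11) * X ^ 10 * β ^ (3 * ε + 2 * (3 * θ + δ) - 1 / 2) := by
          rw [hrpow, hrpow]; congr 1 <;> congr 1 <;> [congr 1; congr 1] <;> ring_nf
      _ ≤ 2 * β ^ (-θ) := by linarith
  -- (t5) the `√P` term
  have hsP0 : 0 ≤ Real.sqrt P := Real.sqrt_nonneg _
  have ht5 : Real.sqrt P * (2 * β ^ (2 * ε) * (6 * R' ^ 2 + 11) + (26 * R' ^ 4 + 261) + (6 * R' ^ 2 + 11) ^ 2) ≤ 2 * β ^ (-θ) := by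
    have hin : 2 * β ^ (2 * ε) * (6 * R' ^ 2 + 11) + (26 * R' ^ 4 + 261) + (6 * R' ^ 2 + 11) ^ 2 ≤
        2 * β ^ (2 * ε) * ((6 * 2400006 ^ 2 + 11) * X ^ 4 * β ^ (2 * (3 * θ + δ))) +
          4 * ((6 * 2400006 ^ 2 + 11) ^ 2 * X ^ 8 * β ^ (4 * (3 * θ + δ))) := by
      have h1' : 2 * β ^ (2 * ε) * (6 * R' ^ 2 + 11) ≤ 2 * β ^ (2 * ε) * ((6 * 2400006 ^ 2 + 11) * X ^ 4 * β ^ (2 * (3 * θ + δ))) :=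
        mul_le_mul_of_nonneg_left hK1 (by positivity)
      linarith
    have hin0 : 0 ≤ 2 * β ^ (2 * ε) * (6 * R' ^ 2 + 11) + (26 * R' ^ 4 + 261) + (6 * R' ^ 2 + 11) ^ 2 := by positivity
    calc Real.sqrt P * (2 * β ^ (2 * ε) * (6 * R' ^ 2 + 11) + (26 * R' ^ 4 + 261) + (6 * R' ^ 2 + 11) ^ 2)
        ≤ (27 * X ^ 2 * E) * (2 * β ^ (2 * ε) * ((6 * 2400006 ^ 2 + 11) * X ^ 4 * β ^ (2 * (3 * θ + δ))) +
          4 * ((6 * 2400006 ^ 2 + 11) ^ 2 * X ^ 8 * β ^ (4 * (3 * θ + δ)))) := mul_le_mul hsqPle hin hin0 (by positivity)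
      _ = β ^ (2 * ε) * β ^ (2 * (3 * θ + δ)) * (54 * (6 * 2400006 ^ 2 + 11) * X ^ 6 * E) +
          β ^ (4 * (3 * θ + δ)) * (108 * (6 * 2400006 ^ 2 + 11) ^ 2 * X ^ 10 * E) := by ring
      _ ≤ β ^ (2 * ε) * β ^ (2 * (3 * θ + δ)) * β ^ (-θ - (2 * ε + 2 * (3 * θ + δ))) +
          β ^ (4 * (3 * θ + δ)) * β ^ (-θ - 4 * (3 * θ + δ)) :=
          add_le_add (mul_le_mul_of_nonneg_left h5a (by positivity)) (mul_le_mul_of_nonneg_left h5b (by positivity))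
      _ = 2 * β ^ (-θ) := by
          rw [hrpow, hrpow, hrpow]; ring_nf
  -- (t1) and the sum
  have ht1 : 96 * β ^ 2 * E ≤ β ^ (-θ) := by
    have : (β ^ (2 : ℝ)) = β ^ (2 : ℕ) := by rw [← Real.rpow_natCast]; norm_num
    rw [← this]; exact h1
  have hfin := add_le_add ht1 (add_le_add (add_le_add (add_le_add ht2 ht3) ht4) ht5)
  refine hfin.trans ?_
  linarith

end Summit.QuantumFields.YangMills.Theorems.WeakCouplingRates

end
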